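import Summits.ResolutionOfSingularities.ResolutionOfSingularities.Theses.RuledResidues
import Literature.AlgebraicGeometry.Resolution.RegularLocalRingsProofs

/-!
# `RuledResidues.NonRuledDivisors` — line `automorphism-orbit`, stub `stub_transportSingular`

Registered stub of `Cruxes/NonRuledDivisors/Lines/automorphism_orbit.lean` (crux stmt-ResolutionOfSingularities-18075),
proved verbatim (signature = the registered one).  A valuation ring dominating a singular prime `P` of `S` is centred at a non-regular point of `Spec S` (Serre: localisations of regular local rings are regular).
-/

-- dupNamespace: the problem namespace legitimately repeats the summit name
set_option linter.dupNamespace false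

namespace Summit.ResolutionOfSingularities.ResolutionOfSingularities.Theorems

/-- Stub 2b of line `automorphism-orbit` (crux `RuledResidues.NonRuledDivisors`): if `S_P` is not regular and `W ⊇ S` has `P ⊆ 𝔪_W`, then `S` localised at the centre of `W` is not regular. [cite: Matsumura1987, Thm. 19.3] -/
theorem stub_transportSingular : ∀ (K : Type) [Field K] (S : Subring K) (P : Ideal S) [P.IsPrime], ¬ IsRegularLocalRing (Localization.AtPrime P) → ∀ (W' : ValuationSubring K) (h : S ≤ W'.toSubring), (∀ r : S, r ∈ P → (r : K) ∈ W'.nonunits) → ¬ IsRegularLocalRing (Localization.AtPrime (Ideal.comap (Subring.inclusion h) (IsLocalRing.maximalIdeal W'))) := by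
  intro K _ S P hP hsing W' h hdom hreg
  apply hsing
  -- the centre `Q` of `W'` on `S` contains `P` (domination)
  set Q : Ideal S := Ideal.comap (Subring.inclusion h) (IsLocalRing.maximalIdeal W') with hQdef
  have hPQ : P ≤ Q := by
    intro r hr
    rw [hQdef, Ideal.mem_comap]
    have hr' : ((Subring.inclusion h r : W') : K) ∈ W'.nonunits := by
      rw [Subring.coe_inclusion]
      exact hdom r hr
    exact ValuationSubring.coe_mem_nonunits_iff.mp hr'
  -- `S_P = (S_Q)_{P S_Q}` is regular by Serre (Matsumura Thm. 19.3)
  set SQ := Localization.AtPrime Q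
  have hdisj : Disjoint (Q.primeCompl : Set S) (P : Set S) :=
    Set.disjoint_left.mpr fun a ha haP => ha (hPQ haP)
  set P' : Ideal SQ := P.map (algebraMap S SQ)
  haveI hP'p : P'.IsPrime :=
    IsLocalization.isPrime_of_isPrime_disjoint Q.primeCompl SQ P hP hdisj
  have hunder : P'.comap (algebraMap S SQ) = P :=
    IsLocalization.under_map_of_isPrime_disjoint Q.primeCompl SQ hP hdisj
  have hM : P.primeCompl = (P'.comap (algebraMap S SQ)).primeCompl := by
    ext a
    change a ∉ P ↔ a ∉ P'.comap (algebraMap S SQ)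
    rw [hunder]
  have hreg' : IsRegularLocalRing (Localization.AtPrime P') :=
    Literature.AlgebraicGeometry.Resolution.isRegularLocalRing_localization_atPrime SQ P'
  have hloc : IsLocalization.AtPrime (Localization.AtPrime P') P := by
    have hl := IsLocalization.isLocalization_isLocalization_atPrime_isLocalization
      Q.primeCompl (Localization.AtPrime P') P'
    unfold IsLocalization.AtPrime at hl ⊢
    rwa [hM]
  have e : Localization.AtPrime P' ≃+* Localization.AtPrime P :=
    (IsLocalization.algEquiv P.primeCompl (Localization.AtPrime P')
      (Localization.AtPrime P)).toRingEquiv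
  exact IsRegularLocalRing.of_ringEquiv (R := Localization.AtPrime P') e

end Summit.ResolutionOfSingularities.ResolutionOfSingularities.Theorems
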